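import Summits.CriticalPhenomena.CardyFormulaZ2.Theses.CardyWickAnisotropy

/-!
Scratch for the crux idea `physical-strip-normality` (crux-strategist, stmt-CriticalPhenomena-14309):
the spectral-parameter coordinate `u ↦ p(u) = sin u / cos (u − π/6)` (six-vertex / TL spectral parameter at
crossing parameter λ = π/3, i.e. `p / (1 − p) = sin u / sin (λ − u)`), in which

* the LENS `Λ = {|p| < 1} ∩ {|p − 1| < 1}` (empirical maximal domain of convergence, NUMERICS.md) is the image
  of the PHYSICAL STRIP `0 < Re u < λ`; `Re u = 0 ↦ |p − 1| = 1`, `Re u = λ ↦ |p| = 1`, `Re u = λ/2 ↦ Re p = 1/2`;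
* the route's horizontal weight is `criticalWeight (α/2) = p (α/3)`: the anisotropy angle is `α = 3u = (π/λ)·u`
  (Kim–Pearce), so the angle map linearises and the Cardy side is `u ↦ Π_h (cot (3u/2))`.
-/

namespace Summit.CriticalPhenomena.CardyFormulaZ2.Cruxes.AnisotropicBoxCardy.PhysicalStrip

open scoped Classical
open Filter Topology

/-- The spectral-parameter coordinate. -/
noncomputable def pOfU (u : ℂ) : ℂ := Complex.sin u / Complex.cos (u - Real.pi / 6)

/-- FIRST LEMMA (support, provable now): the physical strip maps into the lens. -/
def StripToLens : Prop :=
  ∀ u : ℂ, 0 < u.re → u.re < Real.pi / 3 → ‖pOfU u‖ < 1 ∧ ‖pOfU u - 1‖ < 1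

/-- FIRST LEMMA, boundary form: `Re u = 0 ↦ |p − 1| = 1` and `Re u = π/3 ↦ |p| = 1` (where defined). -/
def StripEdgesToArcs : Prop :=
  (∀ t : ℝ, ‖pOfU (t * Complex.I) - 1‖ = 1) ∧ (∀ t : ℝ, ‖pOfU (Real.pi / 3 + t * Complex.I)‖ = 1)

/-- Real dictionary with the route's weight: `criticalWeight (α/2) = sin (α/3) / cos (α/3 − π/6)`. -/
def AngleIsThreeU : Prop :=
  ∀ α : ℝ, Literature.Probability.LatticeModels.criticalWeight (α / 2) =
    Real.sin (α / 3) / Real.cos (α / 3 - Real.pi / 6)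

/-- S⁺ (strengthen): STRIP NORMALITY — the crossing amplitudes, read in the spectral parameter, are locally bounded on
the whole physical strip (⇒ `DiscNormality`, since `{‖2p − 1‖ ≤ ρ} ⊂ Λ = pOfU '' strip` is compact there). -/
def StripNormality : Prop :=
  let E : ℕ → Finset (Sym2 (Literature.Probability.LatticeModels.Site 2)) := fun n ↦ ((Literature.Probability.Percolation.rectangle (n + 1) n ×ˢ Literature.Probability.Percolation.rectangle (n + 1) n).filter (fun xy ↦ (Literature.Probability.LatticeModels.zdGraph 2).Adj xy.1 xy.2)).image (fun xy ↦ s(xy.1, xy.2)); let w : ℂ → Sym2 (Literature.Probability.LatticeModels.Site 2) → ℂ := fun p e ↦ if (∃ x y : Literature.Probability.LatticeModels.Site 2, e = s(x, y) ∧ x 1 = y 1) then p else 1 - p; let V : ℕ → ℂ → ℂ := fun n p ↦ ∑ ω ∈ (E n).powerset, (if ((ω : Set (Sym2 (Literature.Probability.LatticeModels.Site 2))) ∈ Literature.Probability.Percolation.lrCrossing (n + 1) n) then ∏ e ∈ E n, (if e ∈ ω then w p e else 1 - w p e) else 0);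
  ∀ K : Set ℂ, IsCompact K → K ⊆ {u : ℂ | 0 < u.re ∧ u.re < Real.pi / 3} →
    ∃ C : ℝ, ∀ n : ℕ, ∀ u ∈ K, ‖V n (pOfU u)‖ ≤ C

/-- The transfer this idea proposes as the line's first stub: strip normality gives the route item. -/
def StripNormalityGivesDisc : Prop :=
  StripNormality → Summit.CriticalPhenomena.CardyFormulaZ2.Theses.CardyWickAnisotropy.DiscNormality

end Summit.CriticalPhenomena.CardyFormulaZ2.Cruxes.AnisotropicBoxCardy.PhysicalStrip
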